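import Summits.CriticalPhenomena.Ising3DConformalLimit.Theorems.EnergyNotSigmaSquaredEnergyGapSoftMerging
import Literature.Probability.LatticeModels.CriticalAxisRatioRegularity
import Summits.CriticalPhenomena.Ising3DConformalLimit.Theorems.MoebiusLimitExists.Negative.RatioRegularCorollaries

/-!
# `EnergyGapSoft`: the tied pairings, second-ratio regularity, and the axis case
(item stmt-CriticalPhenomena-4473, route `EnergyNotSigmaSquared`; sequel to
`EnergyNotSigmaSquaredEnergyGapSoftMerging`)

Notation as there: `G = criticalTwoPoint 3`, `e₂ = Pi.single 1 1`, and for the infinite-volume sourced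
double random current `P^{A,B}_{β_c} = sourcedDoubleCurrentLawInf 3 (criticalBeta 3) A B` on `ℤ³`

* `P_par(x)   = P^{{0}∆{x},{e₂}∆{x+e₂}}_{β_c}[0 ↔ e₂]`,
* `P_cross(x) = P^{{0}∆{x+e₂},{e₂}∆{x}}_{β_c}[0 ↔ e₂]`,
* `P_far(x)   = P^{{0}∆{e₂},{x}∆{x+e₂}}_{β_c}[0 ↔ x]` (two "dipole" currents connect `0` to `x`).

Results (all unconditional; nothing asserts the item):

* `pairings_tied` — Aizenman's identity (ADC21 (3.11)) for the three labellings of the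
  permutation-symmetric `U₄(0,e₂,x,x+e₂)` ties the pairings:
  `G(x)² P_par(x) = G(x+e₂)G(x-e₂) P_cross(x) = G(e₂)² P_far(x)`;
* `adjacentTruncation_eq_ursell` — `⟨σ₀σ_{e₂};σ_xσ_{x+e₂}⟩ = G(x)²(1 - 2P_par(x)) + G(x+e₂)G(x-e₂)`;
* `secondRatioRegular_of_energyGapSoft` — **the item forces `G(x+e₂)G(x-e₂)/G(x)² → 1` as
  `‖x‖ → ∞`, uniformly in the direction** (a lattice ratio-regularity statement; a theorem along an
  axis, `criticalTwoPoint_axis_ratio_tendsto_one`, not known off-axis);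
* `energyGapSoft_iff_parMerging_and_secondRatioRegular` — **item ⟺ `P_par → 1` ∧ that regularity**;
* `dipoleConnection_of_energyGapSoft` — the item forces `G(e₂)² P_far(x)/G(x)² → 1`: Aizenman's bound
  `|U₄| ≤ 2⟨σ₀σ_x⟩⟨σ_{e₂}σ_{x+e₂}⟩` is asymptotically saturated at adjacent quadruples;
* `secondRatio_axis_tendsto_one`, `energyGapSoft_axis_iff_parMerging` — on the `e₂` axis the ratio
  condition is automatic, so the item restricted to `x = n e₂` is EXACTLY "the critical sourced currents
  `0 → n e₂` and `e₂ → (n+1)e₂` merge with probability `→ 1`"; `axisParMerging_of_energyGapSoft`;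
* `secondRatioRegular_of_moebiusLimit`, `energyGapSoft_iff_parMerging_of_moebiusLimit` — inside the
  route, whose assembly assumes the crux `MoebiusLimit` (item 1344, which forces ratio regularity by the
  tree's `moebiusLimit_implies_ratio_regularity`), the item is EXACTLY parallel adjacent merging
  `P_par(x) → 1` in all directions.

## References

* M. Aizenman, H. Duminil-Copin, Ann. of Math. 194 (2021), §3.2 eqs. (3.10)–(3.12), Prop. 5.3
  [AizenmanDuminilCopinAnnals2021].
* M. Aizenman, Comm. Math. Phys. 86 (1982) 1–48, Prop. 5.2 [AizenmanCMP1982].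
* J. L. Lebowitz, Comm. Math. Phys. 35 (1974) 87–92 [Lebowitz1974].
-/

noncomputable section

namespace Summit.CriticalPhenomena.Ising3DConformalLimit.EnergyNotSigmaSquaredEnergyGapSoft

open scoped symmDiff
open MeasureTheory Filter Topology
open Literature.Probability.LatticeModels Literature.Probability.Percolation
open Summit.CriticalPhenomena.Ising3DConformalLimit.Theses.EnergyNotSigmaSquared
open Summit.CriticalPhenomena.Ising3DConformalLimit.EnergyNotSigmaSquaredGapForcesFarMerging
  (criticalCorr_four_swap12 criticalCorr_four_swap23)
open Summit.CriticalPhenomena.Ising3DConformalLimit.PinnedClusterPoints (criticalTwoPoint_pos3)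

/-! ### The three pairings are tied by permutation symmetry of `U₄` -/

/-- **The pairings are tied.** With `P_par(x) = P^{{0}∆{x},{e₂}∆{x+e₂}}_{β_c}[0 ↔ e₂]`,
`P_cross(x) = P^{{0}∆{x+e₂},{e₂}∆{x}}_{β_c}[0 ↔ e₂]` and the dipole–dipole connection probability
`P_far(x) = P^{{0}∆{e₂},{x}∆{x+e₂}}_{β_c}[0 ↔ x]`, Aizenman's identity (ADC21 (3.11)) for the three
labellings of the permutation-symmetric `U₄(0, e₂, x, x+e₂)` gives
`G(x)² P_par(x) = G(x+e₂) G(x-e₂) P_cross(x) = G(e₂)² P_far(x)`. [cite: AizenmanDuminilCopinAnnals2021, eq. (3.11)] -/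
theorem pairings_tied (x : Site 3) :
    criticalTwoPoint 3 x ^ 2 *
          (sourcedDoubleCurrentLawInf 3 (criticalBeta 3) ({0} ∆ {x})
            ({(Pi.single 1 1 : Site 3)} ∆ {x + Pi.single 1 1})).real (openConn 0 (Pi.single 1 1)) =
        criticalTwoPoint 3 (x + Pi.single 1 1) * criticalTwoPoint 3 (x - Pi.single 1 1) *
          (sourcedDoubleCurrentLawInf 3 (criticalBeta 3) ({0} ∆ {x + Pi.single 1 1})
            ({(Pi.single 1 1 : Site 3)} ∆ {x})).real (openConn 0 (Pi.single 1 1)) ∧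
      criticalTwoPoint 3 x ^ 2 *
          (sourcedDoubleCurrentLawInf 3 (criticalBeta 3) ({0} ∆ {x})
            ({(Pi.single 1 1 : Site 3)} ∆ {x + Pi.single 1 1})).real (openConn 0 (Pi.single 1 1)) =
        criticalTwoPoint 3 (Pi.single 1 1) ^ 2 *
          (sourcedDoubleCurrentLawInf 3 (criticalBeta 3) ({0} ∆ {(Pi.single 1 1 : Site 3)})
            ({x} ∆ {x + Pi.single 1 1})).real (openConn 0 x) := by
  have h1 := (freeUrsellFour_eq_sourcedDoubleCurrent_holds (d := 3)).criticalCorr_eq (by norm_num)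
    0 x (Pi.single 1 1) (x + Pi.single 1 1)
  have h2 := (freeUrsellFour_eq_sourcedDoubleCurrent_holds (d := 3)).criticalCorr_eq (by norm_num)
    0 (x + Pi.single 1 1) (Pi.single 1 1) x
  have h3 := (freeUrsellFour_eq_sourcedDoubleCurrent_holds (d := 3)).criticalCorr_eq (by norm_num)
    0 (Pi.single 1 1) x (x + Pi.single 1 1)
  -- the three four-point functions coincide
  have e1 : criticalCorr 3 4 ![0, x, (Pi.single 1 1 : Site 3), x + Pi.single 1 1] =
      criticalCorr 3 4 ![0, (Pi.single 1 1 : Site 3), x, x + Pi.single 1 1] :=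
    criticalCorr_four_swap12 _ _ _ _
  have e2 : criticalCorr 3 4 ![0, x + Pi.single 1 1, (Pi.single 1 1 : Site 3), x] =
      criticalCorr 3 4 ![0, (Pi.single 1 1 : Site 3), x, x + Pi.single 1 1] := by
    rw [criticalCorr_four_swap12, criticalCorr_four_swap23]
  rw [e1] at h1
  rw [e2] at h2
  -- pair correlators as two-point functions of difference vectors
  simp only [criticalCorr_two_pair, sub_zero, add_sub_cancel_right, add_sub_cancel_left,
    sub_add_cancel_left, sub_add_cancel_right, criticalTwoPoint_neg] at h1 h2 h3
  have e4 : criticalTwoPoint 3 ((Pi.single 1 1 : Site 3) - x) = criticalTwoPoint 3 (x - Pi.single 1 1) :=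
    criticalTwoPoint_sub_comm _ _
  simp only [e4] at h1 h2 h3
  constructor
  · nlinarith [h1, h2]
  · nlinarith [h1, h3]

/-- **The truncation in Ursell form**: `⟨σ₀σ_{e₂} ; σ_xσ_{x+e₂}⟩ = G(x)² (1 - 2 P_par(x)) + G(x+e₂) G(x-e₂)`
(`⟨ε₀;ε_x⟩ = U₄ + W` with `U₄ = -2 G(x)² P_par(x)`). [cite: AizenmanDuminilCopinAnnals2021, eq. (3.11)] -/
theorem adjacentTruncation_eq_ursell (x : Site 3) :
    criticalCorr 3 4 ![0, (Pi.single 1 1 : Site 3), x, x + Pi.single 1 1] -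
        criticalCorr 3 2 ![0, (Pi.single 1 1 : Site 3)] * criticalCorr 3 2 ![x, x + Pi.single 1 1] =
      criticalTwoPoint 3 x ^ 2 *
          (1 - 2 * (sourcedDoubleCurrentLawInf 3 (criticalBeta 3) ({0} ∆ {x})
            ({(Pi.single 1 1 : Site 3)} ∆ {x + Pi.single 1 1})).real (openConn 0 (Pi.single 1 1))) +
        criticalTwoPoint 3 (x + Pi.single 1 1) * criticalTwoPoint 3 (x - Pi.single 1 1) := by
  rw [adjacentTruncation_eq]
  have h := (pairings_tied x).1
  linear_combination h

/-- **`EnergyGapSoft` forces second-ratio regularity of the critical two-point function**: if the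
item holds then `G(x+e₂) G(x-e₂) / G(x)² → 1` as `‖x‖ → ∞`, uniformly in the direction of `x` (for the
two merging probabilities tend to `1` and `G(x)² P_par = G(x+e₂)G(x-e₂) P_cross`). Along a lattice
axis this regularity is a theorem (`criticalTwoPoint_axis_ratio_tendsto_one`); off-axis it is not
known. [cite: AizenmanDuminilCopinAnnals2021, eq. (3.11)] -/
theorem secondRatioRegular_of_energyGapSoft (h : EnergyGapSoft) :
    ∀ ε : ℝ, 0 < ε → ∃ R : ℝ, ∀ x : Site 3, R ≤ ‖x‖ →
      |criticalTwoPoint 3 (x + Pi.single 1 1) * criticalTwoPoint 3 (x - Pi.single 1 1) /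
          criticalTwoPoint 3 x ^ 2 - 1| ≤ ε := by
  intro ε hε
  set ε' : ℝ := min ε 1 / 4 with hε'
  have hε'pos : 0 < ε' := by positivity
  have hε'le : 4 * ε' ≤ ε := by
    rw [hε']; linarith [min_le_left ε 1]
  have hε'le1 : 4 * ε' ≤ 1 := by
    rw [hε']; linarith [min_le_right ε 1]
  obtain ⟨R, hR⟩ := energyGapSoft_iff_adjacentMerging.1 h ε' hε'pos
  refine ⟨R, fun x hx => ?_⟩
  obtain ⟨hpar, hcross⟩ := hR x hx
  set Pp := (sourcedDoubleCurrentLawInf 3 (criticalBeta 3) ({0} ∆ {x})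
    ({(Pi.single 1 1 : Site 3)} ∆ {x + Pi.single 1 1})).real (openConn 0 (Pi.single 1 1)) with hPp
  set Pc := (sourcedDoubleCurrentLawInf 3 (criticalBeta 3) ({0} ∆ {x + Pi.single 1 1})
    ({(Pi.single 1 1 : Site 3)} ∆ {x})).real (openConn 0 (Pi.single 1 1)) with hPc
  have hPp1 : Pp ≤ 1 := sourcedDoubleCurrentLawInf_real_le_one _ _ _ _
  have hPc1 : Pc ≤ 1 := sourcedDoubleCurrentLawInf_real_le_one _ _ _ _
  have htied := (pairings_tied x).1
  have hG2 : 0 < criticalTwoPoint 3 x ^ 2 := pow_pos (criticalTwoPoint_pos3 _) 2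
  set ρ := criticalTwoPoint 3 (x + Pi.single 1 1) * criticalTwoPoint 3 (x - Pi.single 1 1) /
    criticalTwoPoint 3 x ^ 2 with hρ
  have hρeq : criticalTwoPoint 3 (x + Pi.single 1 1) * criticalTwoPoint 3 (x - Pi.single 1 1) =
      ρ * criticalTwoPoint 3 x ^ 2 := by
    rw [hρ, div_mul_cancel₀ _ hG2.ne']
  -- `Pp = ρ * Pc`
  have hkey : Pp = ρ * Pc := by
    have : criticalTwoPoint 3 x ^ 2 * Pp = criticalTwoPoint 3 x ^ 2 * (ρ * Pc) := by
      rw [htied, hρeq]; ring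
    exact mul_left_cancel₀ hG2.ne' this
  have hPc0 : 3 / 4 ≤ Pc := by linarith
  have hPcpos : 0 < Pc := by linarith
  have hρ' : ρ = Pp / Pc := by rw [hkey, mul_div_cancel_right₀ _ hPcpos.ne']
  rw [hρ', div_sub_one hPcpos.ne', abs_div, abs_of_pos hPcpos, div_le_iff₀ hPcpos]
  have : |Pp - Pc| ≤ 2 * ε' := by
    rw [abs_le]; constructor <;> linarith
  calc |Pp - Pc| ≤ 2 * ε' := this
    _ ≤ ε * (3 / 4) := by nlinarith
    _ ≤ ε * Pc := by gcongr

/-- **`EnergyGapSoft` ⟺ parallel merging plus second-ratio regularity**: the item holds iff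
`P_par(x) → 1` (the two critical sourced currents `0 → x` and `e₂ → x + e₂` merge) and
`G(x+e₂)G(x-e₂)/G(x)² → 1`, both as `‖x‖ → ∞`. [cite: AizenmanDuminilCopinAnnals2021, eq. (3.11)] -/
theorem energyGapSoft_iff_parMerging_and_secondRatioRegular :
    EnergyGapSoft ↔
      (∀ ε : ℝ, 0 < ε → ∃ R : ℝ, ∀ x : Site 3, R ≤ ‖x‖ →
        1 - (sourcedDoubleCurrentLawInf 3 (criticalBeta 3) ({0} ∆ {x})
              ({(Pi.single 1 1 : Site 3)} ∆ {x + Pi.single 1 1})).real (openConn 0 (Pi.single 1 1)) ≤ ε) ∧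
      (∀ ε : ℝ, 0 < ε → ∃ R : ℝ, ∀ x : Site 3, R ≤ ‖x‖ →
        |criticalTwoPoint 3 (x + Pi.single 1 1) * criticalTwoPoint 3 (x - Pi.single 1 1) /
            criticalTwoPoint 3 x ^ 2 - 1| ≤ ε) := by
  constructor
  · intro h
    refine ⟨fun ε hε => ?_, secondRatioRegular_of_energyGapSoft h⟩
    obtain ⟨R, hR⟩ := energyGapSoft_iff_adjacentMerging.1 h ε hε
    exact ⟨R, fun x hx => (hR x hx).1⟩
  · rintro ⟨hpar, hratio⟩ ε hε
    obtain ⟨R₁, hR₁⟩ := hpar (ε / 4) (by positivity)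
    obtain ⟨R₂, hR₂⟩ := hratio (ε / 2) (by positivity)
    refine ⟨max R₁ R₂, fun x hx => ?_⟩
    have h1 := hR₁ x ((le_max_left _ _).trans hx)
    have h2 := hR₂ x ((le_max_right _ _).trans hx)
    rw [adjacentTruncation_eq_ursell]
    have hG2 : 0 < criticalTwoPoint 3 x ^ 2 := pow_pos (criticalTwoPoint_pos3 _) 2
    set ρ := criticalTwoPoint 3 (x + Pi.single 1 1) * criticalTwoPoint 3 (x - Pi.single 1 1) /
      criticalTwoPoint 3 x ^ 2 with hρ
    have hρeq : criticalTwoPoint 3 (x + Pi.single 1 1) * criticalTwoPoint 3 (x - Pi.single 1 1) =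
        ρ * criticalTwoPoint 3 x ^ 2 := by
      rw [hρ, div_mul_cancel₀ _ hG2.ne']
    rw [hρeq]
    have hρle : ρ ≤ 1 + ε / 2 := by linarith [(abs_le.1 h2).2]
    set Pp := (sourcedDoubleCurrentLawInf 3 (criticalBeta 3) ({0} ∆ {x})
      ({(Pi.single 1 1 : Site 3)} ∆ {x + Pi.single 1 1})).real (openConn 0 (Pi.single 1 1)) with hPp
    have hP : 1 - ε / 4 ≤ Pp := by linarith
    nlinarith

/-- **`EnergyGapSoft` in dipole form**: the item forces `G(e₂)² P_far(x) / G(x)² → 1`, i.e. the two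
critical "dipole" currents with sources `{0, e₂}` and `{x, x + e₂}` connect `0` to `x` with probability
asymptotic to `⟨σ₀σ_x⟩² / ⟨σ₀σ_{e₂}⟩²` — the Aizenman bound `|U₄| ≤ 2⟨σ₀σ_x⟩⟨σ_{e₂}σ_{x+e₂}⟩` is
asymptotically saturated at adjacent quadruples. [cite: AizenmanDuminilCopinAnnals2021, eqs. (3.11)–(3.12)] -/
theorem dipoleConnection_of_energyGapSoft (h : EnergyGapSoft) :
    ∀ ε : ℝ, 0 < ε → ∃ R : ℝ, ∀ x : Site 3, R ≤ ‖x‖ →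
      |criticalTwoPoint 3 (Pi.single 1 1) ^ 2 *
            (sourcedDoubleCurrentLawInf 3 (criticalBeta 3) ({0} ∆ {(Pi.single 1 1 : Site 3)})
              ({x} ∆ {x + Pi.single 1 1})).real (openConn 0 x) /
          criticalTwoPoint 3 x ^ 2 - 1| ≤ ε := by
  intro ε hε
  obtain ⟨R, hR⟩ := energyGapSoft_iff_adjacentMerging.1 h ε hε
  refine ⟨R, fun x hx => ?_⟩
  have hpar := (hR x hx).1
  have htied := (pairings_tied x).2
  have hG2 : 0 < criticalTwoPoint 3 x ^ 2 := pow_pos (criticalTwoPoint_pos3 _) 2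
  rw [← htied, mul_div_cancel_left₀ _ hG2.ne']
  have hP1 := sourcedDoubleCurrentLawInf_real_le_one (criticalBeta 3) ({0} ∆ {x})
    ({(Pi.single 1 1 : Site 3)} ∆ {x + Pi.single 1 1}) (openConn 0 (Pi.single 1 1))
  rw [abs_le]; constructor <;> linarith

/-! ### Along the `e₂` axis the ratio condition is a theorem, so the item is pure merging there -/

/-- Along the `e₂` axis the second ratio tends to one:
`G((k+2)e₂) G(k e₂) / G((k+1)e₂)² → 1` (axis ratio regularity, `criticalTwoPoint_axis_ratio_tendsto_one'`,
applied twice). [cite: AizenmanDuminilCopinAnnals2021, arXiv:1912.07973 Prop. 5.3 (5.17) and §5.5 proof of Prop. 5.9 (p. 19)] -/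
theorem secondRatio_axis_tendsto_one :
    Tendsto (fun k : ℕ => criticalTwoPoint 3 (Pi.single 1 ((k + 2 : ℕ) : ℤ)) *
      criticalTwoPoint 3 (Pi.single 1 (k : ℤ)) / criticalTwoPoint 3 (Pi.single 1 ((k + 1 : ℕ) : ℤ)) ^ 2)
      atTop (𝓝 1) := by
  have h1 := criticalTwoPoint_axis_ratio_tendsto_one (1 : Fin 3)
  have h2 := criticalTwoPoint_axis_ratio_tendsto_one' (1 : Fin 3)
  have h3 := h1.div h2 one_ne_zero
  rw [div_one] at h3
  refine h3.congr fun k => ?_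
  rw [Pi.div_apply, div_div_eq_mul_div, div_mul_eq_mul_div, div_div, ← sq]

/-- **On the `e₂` axis, `EnergyGapSoft` is exactly parallel merging**: the item restricted to the targets
`x = n e₂` (collinear with the bond `(0, e₂)`) holds iff the two critical sourced currents `0 → n e₂` and
`e₂ → (n+1) e₂` merge with probability `→ 1` as `n → ∞`; the ratio condition of
`energyGapSoft_iff_parMerging_and_secondRatioRegular` is automatic there. [cite: AizenmanDuminilCopinAnnals2021, eq. (3.11)] -/
theorem energyGapSoft_axis_iff_parMerging :
    (∀ ε : ℝ, 0 < ε → ∃ N : ℕ, ∀ n : ℕ, N ≤ n →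
        criticalCorr 3 4 ![0, (Pi.single 1 1 : Site 3), Pi.single 1 (n : ℤ), Pi.single 1 (n : ℤ) + Pi.single 1 1] -
            criticalCorr 3 2 ![0, (Pi.single 1 1 : Site 3)] *
              criticalCorr 3 2 ![(Pi.single 1 (n : ℤ) : Site 3), Pi.single 1 (n : ℤ) + Pi.single 1 1] ≤
          ε * criticalTwoPoint 3 (Pi.single 1 (n : ℤ)) ^ 2) ↔
      ∀ ε : ℝ, 0 < ε → ∃ N : ℕ, ∀ n : ℕ, N ≤ n →
        1 - (sourcedDoubleCurrentLawInf 3 (criticalBeta 3) ({0} ∆ {(Pi.single 1 (n : ℤ) : Site 3)})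
            ({(Pi.single 1 1 : Site 3)} ∆ {Pi.single 1 (n : ℤ) + Pi.single 1 1})).real
              (openConn 0 (Pi.single 1 1)) ≤ ε := by
  constructor
  · intro h ε hε
    obtain ⟨N, hN⟩ := h ε hε
    refine ⟨N, fun n hn => ?_⟩
    have hT := hN n hn
    set x : Site 3 := Pi.single 1 (n : ℤ) with hx
    rw [adjacentTruncation_eq] at hT
    have hA₂0 := one_sub_sourcedDoubleCurrentLawInf_real_nonneg (criticalBeta 3) ({0} ∆ {x + Pi.single 1 1})
      ({(Pi.single 1 1 : Site 3)} ∆ {x}) (openConn 0 (Pi.single 1 1))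
    have hP0 : 0 ≤ criticalTwoPoint 3 (x + Pi.single 1 1) * criticalTwoPoint 3 (x - Pi.single 1 1) :=
      mul_nonneg (criticalTwoPoint_nonneg' _) (criticalTwoPoint_nonneg' _)
    have hG2 : 0 < criticalTwoPoint 3 x ^ 2 := pow_pos (criticalTwoPoint_pos3 _) 2
    have h2 : criticalTwoPoint 3 x ^ 2 *
        (1 - (sourcedDoubleCurrentLawInf 3 (criticalBeta 3) ({0} ∆ {x})
          ({(Pi.single 1 1 : Site 3)} ∆ {x + Pi.single 1 1})).real (openConn 0 (Pi.single 1 1))) ≤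
        criticalTwoPoint 3 x ^ 2 * ε := by
      nlinarith [mul_nonneg hP0 hA₂0]
    exact le_of_mul_le_mul_left h2 hG2
  · intro h ε hε
    obtain ⟨N₁, hN₁⟩ := h (ε / 4) (by positivity)
    have hratio := (secondRatio_axis_tendsto_one.comp (tendsto_sub_atTop_nat 1))
    have hev := (tendsto_order.1 hratio).2 (1 + ε / 2) (by linarith)
    obtain ⟨N₂, hN₂⟩ := eventually_atTop.1 hev
    refine ⟨max (max N₁ N₂) 1, fun n hn => ?_⟩
    have hn1 : N₁ ≤ n := le_trans (le_trans (le_max_left _ _) (le_max_left _ _)) hn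
    have hn2 : N₂ ≤ n := le_trans (le_trans (le_max_right _ _) (le_max_left _ _)) hn
    have hn3 : 1 ≤ n := le_trans (le_max_right _ _) hn
    have h1 := hN₁ n hn1
    have h2 := hN₂ n hn2
    simp only [Function.comp_apply] at h2
    rw [show n - 1 + 2 = n + 1 by omega, show n - 1 + 1 = n by omega] at h2
    set x : Site 3 := Pi.single 1 (n : ℤ) with hx
    have hxp : x + Pi.single 1 1 = Pi.single 1 ((n + 1 : ℕ) : ℤ) := by
      rw [hx, ← Pi.single_add]; push_cast; rfl
    have hxm : x - Pi.single 1 1 = Pi.single 1 ((n - 1 : ℕ) : ℤ) := by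
      rw [hx, ← Pi.single_sub]; push_cast [hn3]; rfl
    rw [adjacentTruncation_eq_ursell, hxp, hxm]
    rw [hxp] at h1
    have hG2 : 0 < criticalTwoPoint 3 x ^ 2 := pow_pos (criticalTwoPoint_pos3 _) 2
    set ρ := criticalTwoPoint 3 (Pi.single 1 ((n + 1 : ℕ) : ℤ)) * criticalTwoPoint 3 (Pi.single 1 ((n - 1 : ℕ) : ℤ)) /
      criticalTwoPoint 3 x ^ 2 with hρ
    have hρeq : criticalTwoPoint 3 (Pi.single 1 ((n + 1 : ℕ) : ℤ)) * criticalTwoPoint 3 (Pi.single 1 ((n - 1 : ℕ) : ℤ)) =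
        ρ * criticalTwoPoint 3 x ^ 2 := by
      rw [hρ, div_mul_cancel₀ _ hG2.ne']
    rw [hρeq]
    have hρle : ρ ≤ 1 + ε / 2 := h2.le
    set Pp := (sourcedDoubleCurrentLawInf 3 (criticalBeta 3) ({0} ∆ {x})
      ({(Pi.single 1 1 : Site 3)} ∆ {Pi.single 1 ((n + 1 : ℕ) : ℤ)})).real (openConn 0 (Pi.single 1 1)) with hPp
    have hP : 1 - ε / 4 ≤ Pp := by linarith
    nlinarith

/-- In particular `EnergyGapSoft` forces axis merging: `P_par(n e₂) → 1`. [cite: AizenmanDuminilCopinAnnals2021, eq. (3.11)] -/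
theorem axisParMerging_of_energyGapSoft (h : EnergyGapSoft) :
    ∀ ε : ℝ, 0 < ε → ∃ N : ℕ, ∀ n : ℕ, N ≤ n →
      1 - (sourcedDoubleCurrentLawInf 3 (criticalBeta 3) ({0} ∆ {(Pi.single 1 (n : ℤ) : Site 3)})
          ({(Pi.single 1 1 : Site 3)} ∆ {Pi.single 1 (n : ℤ) + Pi.single 1 1})).real
            (openConn 0 (Pi.single 1 1)) ≤ ε := by
  intro ε hε
  obtain ⟨R, hR⟩ := energyGapSoft_iff_adjacentMerging.1 h ε hε
  obtain ⟨N, hN⟩ := exists_nat_ge R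
  refine ⟨N, fun n hn => (hR _ ?_).1⟩
  have hnorm : ‖(Pi.single 1 (n : ℤ) : Site 3)‖ = n := by
    rw [Pi.norm_single, Int.norm_eq_abs]; push_cast; exact abs_of_nonneg (by positivity)
  rw [hnorm]
  exact hN.trans (by exact_mod_cast hn)

/-! ### Inside the route: given the crux `MoebiusLimit`, the item is parallel merging alone -/

/-- A cofinite eventuality on `ℤ³` holds beyond some sup-norm radius. [folklore] -/
theorem exists_radius_of_eventually_cofinite {p : Site 3 → Prop} (h : ∀ᶠ x in cofinite, p x) :
    ∃ R : ℝ, ∀ x : Site 3, R ≤ ‖x‖ → p x := by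
  rw [Filter.eventually_cofinite] at h
  obtain ⟨M, hM⟩ := (h.image fun x => ‖x‖).bddAbove
  refine ⟨M + 1, fun x hx => ?_⟩
  by_contra hpx
  have hxM : ‖x‖ ≤ M := hM ⟨x, hpx, rfl⟩
  linarith

/-- **The route's crux `MoebiusLimit` (item 1344) supplies the ratio condition**: a Möbius-covariant
non-degenerate pointwise scaling limit forces ratio regularity `G(x+u)/G(x) → 1`
(`moebiusLimit_implies_ratio_regularity`), hence `G(x+e₂)G(x-e₂)/G(x)² → 1`. [folklore] -/
theorem secondRatioRegular_of_moebiusLimit (hM : MoebiusLimit) :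
    ∀ ε : ℝ, 0 < ε → ∃ R : ℝ, ∀ x : Site 3, R ≤ ‖x‖ →
      |criticalTwoPoint 3 (x + Pi.single 1 1) * criticalTwoPoint 3 (x - Pi.single 1 1) /
          criticalTwoPoint 3 x ^ 2 - 1| ≤ ε := by
  intro ε hε
  have h1 := MoebiusLimitExistsNegative.moebiusLimit_implies_ratio_regularity hM (Pi.single 1 1)
  have h2 := MoebiusLimitExistsNegative.moebiusLimit_implies_ratio_regularity hM (-(Pi.single 1 1))
  have h3 := h1.mul h2
  rw [mul_one] at h3
  have hev := (Metric.tendsto_nhds.1 h3) ε hε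
  obtain ⟨R, hR⟩ := exists_radius_of_eventually_cofinite hev
  refine ⟨R, fun x hx => ?_⟩
  have h := (hR x hx).le
  rw [Real.dist_eq, ← sub_eq_add_neg, div_mul_div_comm, ← sq] at h
  exact h

/-- **Given `MoebiusLimit`, `EnergyGapSoft` ⟺ parallel adjacent merging** `P_par(x) → 1`.
[cite: AizenmanDuminilCopinAnnals2021, eq. (3.11)] -/
theorem energyGapSoft_iff_parMerging_of_moebiusLimit (hM : MoebiusLimit) :
    EnergyGapSoft ↔
      ∀ ε : ℝ, 0 < ε → ∃ R : ℝ, ∀ x : Site 3, R ≤ ‖x‖ →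
        1 - (sourcedDoubleCurrentLawInf 3 (criticalBeta 3) ({0} ∆ {x})
              ({(Pi.single 1 1 : Site 3)} ∆ {x + Pi.single 1 1})).real (openConn 0 (Pi.single 1 1)) ≤ ε := by
  rw [energyGapSoft_iff_parMerging_and_secondRatioRegular]
  exact ⟨fun h => h.1, fun h => ⟨h, secondRatioRegular_of_moebiusLimit hM⟩⟩

/-- Hence, inside route `EnergyNotSigmaSquared` (whose assembly assumes `MoebiusLimit`), item 4473
follows from parallel adjacent merging alone. [cite: AizenmanDuminilCopinAnnals2021, eq. (3.11)] -/
theorem energyGapSoft_of_moebiusLimit_of_parMerging (hM : MoebiusLimit)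
    (hmerge : ∀ ε : ℝ, 0 < ε → ∃ R : ℝ, ∀ x : Site 3, R ≤ ‖x‖ →
        1 - (sourcedDoubleCurrentLawInf 3 (criticalBeta 3) ({0} ∆ {x})
              ({(Pi.single 1 1 : Site 3)} ∆ {x + Pi.single 1 1})).real (openConn 0 (Pi.single 1 1)) ≤ ε) :
    EnergyGapSoft :=
  (energyGapSoft_iff_parMerging_of_moebiusLimit hM).2 hmerge

end Summit.CriticalPhenomena.Ising3DConformalLimit.EnergyNotSigmaSquaredEnergyGapSoft

end
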